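import Literature.NumberTheory.LFunctions.ThetaChainFreeCheck
import HarnessLib

/-!
# Schoenfeld's `θ`-bound on `[599, 10⁸]` by kernel computation: data-free run, chunk 11 of 35

Topic: `Literature/NumberTheory/LFunctions`. Pure proof file (a kernel computation; nothing is
asserted, no definition). The theorems below evaluate `ThetaChain.runFree` — together `150000`
data-free steps of the certified `θ`-chain (`ThetaChain.stepFree`, `ThetaChainFreeCheck.lean`: the
next prime found and certified by two gcds with the primorials of the odd primes `≤ 2999` and in
`(2999, 10007]`, the enclosures of `log p` and `θ(p)`, and the two comparisons behind
`|θ(x) − x| ≤ √x log² x/(8π)`) — from the state at the prime `34104097` to the state at the prime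
`36715453`. Soundness: `ThetaChain.runFree_sound`; assembly of the 35 chunks: `ThetaUpTo1e8.lean`.
The expected states were obtained by evaluating a twin of the same function outside the kernel
(validated bit-for-bit on the tree's chunk `ThetaChainRun.xrun14`). Declarations of `5·10⁴` steps
(about `70 s` of kernel time each; the kernel's evaluation is linear within a declaration of this size),
`decide +kernel`, standard axioms only (`maxHeartbeats 0` lifts the deterministic time-out).

## References

* L. Schoenfeld, *Sharper bounds for the Chebyshev functions θ(x) and ψ(x). II*, Math. Comp. 30
  (1976), 337–360, Thm. 10 (6.3). [Schoenfeld1976]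
* J. B. Rosser, L. Schoenfeld, *Approximate formulas for some functions of prime numbers*,
  Illinois J. Math. 6 (1962), 64–94, Thms. 18–19 (`θ`-tables to `10⁸`). [RosserSchoenfeld1962]
-/

namespace Literature.NumberTheory.LFunctions.ThetaChainRun

open ThetaChain

set_option maxHeartbeats 0 in
/-- **Data-free certified `θ`-run, chunk 11a** (steps `1500001`–`1550000` after `8886113`: 50000 primes,
`34104097` to `34974869`). [cite: Schoenfeld1976, Thm. 10 (6.3)] -/
theorem frun11a :
    runFree 50000
      ⟨34104097, 20968731397282554925710539, 20968731397283030575540136, 41223293759949028924713435132915, 41223293759950025528857656504554⟩ =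
    some ⟨34974869, 20999211138864242146908819, 20999211138864717797701471, 42272497386903173835530237088964, 42272497386904194222190014536963⟩ := by
  decide +kernel

set_option maxHeartbeats 0 in
/-- **Data-free certified `θ`-run, chunk 11b** (steps `1550001`–`1600000` after `8886113`: 50000 primes,
`34974869` to `35844257`). [cite: Schoenfeld1976, Thm. 10 (6.3)] -/
theorem frun11b :
    runFree 50000
      ⟨34974869, 20999211138864242146908819, 20999211138864717797701471, 42272497386903173835530237088964, 42272497386904194222190014536963⟩ =
    some ⟨35844257, 21028894600456976016619159, 21028894600457451668373586, 43323203746902056515530727241661, 43323203746903100684754194198305⟩ := by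
  decide +kernel

set_option maxHeartbeats 0 in
/-- **Data-free certified `θ`-run, chunk 11c** (steps `1600001`–`1650000` after `8886113`: 50000 primes,
`35844257` to `36715453`). [cite: Schoenfeld1976, Thm. 10 (6.3)] -/
theorem frun11c :
    runFree 50000
      ⟨35844257, 21028894600456976016619159, 21028894600457451668373586, 43323203746902056515530727241661, 43323203746903100684754194198305⟩ =
    some ⟨36715453, 21057926192577730370727307, 21057926192578206023442154, 44375376777138817190703379095784, 44375376777139885142538579438983⟩ := by
  decide +kernel

end Literature.NumberTheory.LFunctions.ThetaChainRun
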